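import Mathlib
import Summits.Ventures.PercRepro2.Defs
import Summits.Ventures.PercRepro2.CoinTraceBlock
import Summits.Ventures.PercRepro2.CoinTraceShift

/-!
# Two more SIGN BLOCKS of the pendant method (blind cell PercRepro2, night-2 g4;
proofs/NIGHT2-DARC.md §23.1)

* `avoidU_block_nonneg` — block (a) for a general AVOIDANCE family `𝒩_U`, `w ∈ U ⊆ P`;
* `cylinder₂_block_nonneg` — the block of a PAIR cylinder `{Z ⊇ {v, v'}}` with the pivotal data,
  given positive association on the pair cylinder (supplied by pinning both coins, see
  `trace_cu_pa_pair`), with the shift `shift_mem₂_of_tracePA`.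
Both are `block_nonneg` (CoinTraceBlock.lean) with the shifts of CoinTraceShift.lean; they are
the two blocks the hard up-set of the pathstar needs (CoinPathStarHard.lean).
-/

namespace Summit.Ventures.PercRepro2.Coin

section Blocks2

open Classical

variable {V : Type*} [DecidableEq V] {R : Type*} [Field R] [LinearOrder R] [IsStrictOrderedRing R]

/-- **The shift on a PAIR cylinder** (`x` decreasing, `≤ 1`; from (AV-PA) on the whole family
against the indicator of `v ∈ Z ∧ v' ∈ Z`): `Σ_{Z ∋ v, v'} x μ · Λ ≤ MX · μ({Z ∋ v, v'})`. -/
lemma shift_mem₂_of_tracePA (P : Finset V) (μ x : Finset V → R) (hPA : TracePA P μ)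
    (hx1 : ∀ Z : Finset V, Z ⊆ P → x Z ≤ 1)
    (hxanti : ∀ Z Z' : Finset V, Z ⊆ Z' → Z' ⊆ P → x Z' ≤ x Z) (v v' : V) :
    (∑ Z ∈ P.powerset.filter (fun Z => v ∈ Z ∧ v' ∈ Z), x Z * μ Z) * ∑ Z ∈ P.powerset, μ Z ≤
      (∑ Z ∈ P.powerset, x Z * μ Z) *
        ∑ Z ∈ P.powerset.filter (fun Z => v ∈ Z ∧ v' ∈ Z), μ Z := by
  have h := hPA ∅ (Finset.empty_subset P) (fun Z => 1 - x Z)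
    (fun Z => if v ∈ Z ∧ v' ∈ Z then 1 else 0)
    (fun Z Z' hZZ' hZ'P => by
      show 1 - x Z ≤ 1 - x Z'
      linarith [hxanti Z Z' hZZ' hZ'P])
    (fun Z Z' hZZ' _ => by
      show (if v ∈ Z ∧ v' ∈ Z then (1 : R) else 0) ≤ if v ∈ Z' ∧ v' ∈ Z' then 1 else 0
      by_cases hZ : v ∈ Z ∧ v' ∈ Z
      · rw [if_pos hZ, if_pos ⟨hZZ' hZ.1, hZZ' hZ.2⟩]
      · rw [if_neg hZ]
        split_ifs <;> norm_num)
    (fun Z hZ => by show 0 ≤ 1 - x Z; linarith [hx1 Z hZ])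
    (fun Z _ => by
      show 0 ≤ if v ∈ Z ∧ v' ∈ Z then (1 : R) else 0
      split_ifs <;> norm_num)
  simp only [filter_disjoint_empty] at h
  have e1 : ∑ Z ∈ P.powerset, (1 - x Z) * μ Z =
      ∑ Z ∈ P.powerset, μ Z - ∑ Z ∈ P.powerset, x Z * μ Z := sum_one_sub_mul _ _ _
  have e2 : ∑ Z ∈ P.powerset, (if v ∈ Z ∧ v' ∈ Z then (1 : R) else 0) * μ Z =
      ∑ Z ∈ P.powerset.filter (fun Z => v ∈ Z ∧ v' ∈ Z), μ Z := sum_ite_mul_eq_sum_filter _ _ _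
  have e3 : ∑ Z ∈ P.powerset, (1 - x Z) * (if v ∈ Z ∧ v' ∈ Z then (1 : R) else 0) * μ Z =
      ∑ Z ∈ P.powerset.filter (fun Z => v ∈ Z ∧ v' ∈ Z), μ Z
        - ∑ Z ∈ P.powerset.filter (fun Z => v ∈ Z ∧ v' ∈ Z), x Z * μ Z := by
    rw [← sum_one_sub_mul, Finset.sum_filter]
    refine Finset.sum_congr rfl fun Z _ => ?_
    split_ifs <;> simp
  rw [e1, e2, e3] at h
  have key : (∑ Z ∈ P.powerset.filter (fun Z => v ∈ Z ∧ v' ∈ Z), μ Z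
        - ∑ Z ∈ P.powerset.filter (fun Z => v ∈ Z ∧ v' ∈ Z), x Z * μ Z) * ∑ Z ∈ P.powerset, μ Z
      - (∑ Z ∈ P.powerset, μ Z - ∑ Z ∈ P.powerset, x Z * μ Z) *
        ∑ Z ∈ P.powerset.filter (fun Z => v ∈ Z ∧ v' ∈ Z), μ Z
      = (∑ Z ∈ P.powerset, x Z * μ Z) * ∑ Z ∈ P.powerset.filter (fun Z => v ∈ Z ∧ v' ∈ Z), μ Z
        - (∑ Z ∈ P.powerset.filter (fun Z => v ∈ Z ∧ v' ∈ Z), x Z * μ Z) *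
          ∑ Z ∈ P.powerset, μ Z := by
    ring
  linarith [h, key]

/-- Block (a) for a general AVOIDANCE family `𝒩_U`, `w ∈ U ⊆ P`: positive association by (AV-PA)
at `U`, shifts `≥ 0` since `x` is decreasing and the indicator of `𝒩_U` is decreasing. -/
theorem avoidU_block_nonneg (P : Finset V) {w : V} (U : Finset V) (hwU : w ∈ U) (hUP : U ⊆ P)
    (μ x y xh yh : Finset V → R) (hμ : ∀ Z ∈ P.powerset, 0 ≤ μ Z)
    (hx1 : ∀ Z : Finset V, Z ⊆ P → x Z ≤ 1) (hy1 : ∀ Z : Finset V, Z ⊆ P → y Z ≤ 1)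
    (hxh1 : ∀ Z : Finset V, Z ⊆ P → xh Z ≤ 1) (hyh1 : ∀ Z : Finset V, Z ⊆ P → yh Z ≤ 1)
    (hxanti : ∀ Z Z' : Finset V, Z ⊆ Z' → Z' ⊆ P → x Z' ≤ x Z)
    (hyanti : ∀ Z Z' : Finset V, Z ⊆ Z' → Z' ⊆ P → y Z' ≤ y Z)
    (hxhanti : ∀ Z Z' : Finset V, Z ⊆ Z' → Z' ⊆ P → xh Z' ≤ xh Z)
    (hyhanti : ∀ Z Z' : Finset V, Z ⊆ Z' → Z' ⊆ P → yh Z' ≤ yh Z)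
    (hxh_eq : ∀ Z : Finset V, Z ⊆ P → w ∉ Z → xh Z = x Z)
    (hyh_eq : ∀ Z : Finset V, Z ⊆ P → w ∉ Z → yh Z = y Z) (hPA : TracePA P μ) :
    0 ≤ ∑ Z ∈ P.powerset.filter (fun Z => Disjoint Z U),
      μ Z * (xh Z * (∑ Z' ∈ P.powerset, μ Z') - ∑ Z' ∈ P.powerset, x Z' * μ Z') *
        (yh Z * (∑ Z' ∈ P.powerset, μ Z') - ∑ Z' ∈ P.powerset, y Z' * μ Z') := by
  have hnw : ∀ Z : Finset V, Disjoint Z U → w ∉ Z :=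
    fun Z hd hwZ => Finset.disjoint_left.mp hd hwZ hwU
  refine block_nonneg _ μ xh yh _ _ _ (fun Z hZ => hμ Z (Finset.mem_filter.mp hZ).1) ?_
    (Or.inl ⟨?_, ?_⟩)
  · exact hPA U hUP (fun Z => 1 - xh Z) (fun Z => 1 - yh Z)
      (fun Z Z' h h' => by show 1 - xh Z ≤ 1 - xh Z'; linarith [hxhanti Z Z' h h'])
      (fun Z Z' h h' => by show 1 - yh Z ≤ 1 - yh Z'; linarith [hyhanti Z Z' h h'])
      (fun Z h => by show 0 ≤ 1 - xh Z; linarith [hxh1 Z h])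
      (fun Z h => by show 0 ≤ 1 - yh Z; linarith [hyh1 Z h])
  · have h := shift_avoid_of_tracePA P μ x hPA hx1 hxanti U
    have e : ∑ Z ∈ P.powerset.filter (fun Z => Disjoint Z U), xh Z * μ Z =
        ∑ Z ∈ P.powerset.filter (fun Z => Disjoint Z U), x Z * μ Z :=
      Finset.sum_congr rfl fun Z hZ => by
        rw [hxh_eq Z (Finset.mem_powerset.mp (Finset.mem_filter.mp hZ).1)
          (hnw Z (Finset.mem_filter.mp hZ).2)]
    rw [e]; exact h
  · have h := shift_avoid_of_tracePA P μ y hPA hy1 hyanti U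
    have e : ∑ Z ∈ P.powerset.filter (fun Z => Disjoint Z U), yh Z * μ Z =
        ∑ Z ∈ P.powerset.filter (fun Z => Disjoint Z U), y Z * μ Z :=
      Finset.sum_congr rfl fun Z hZ => by
        rw [hyh_eq Z (Finset.mem_powerset.mp (Finset.mem_filter.mp hZ).1)
          (hnw Z (Finset.mem_filter.mp hZ).2)]
    rw [e]; exact h

/-- The block of a PAIR cylinder `{Z ⊇ {v, v'}}` with the pivotal data: positive association on
the pair cylinder (the hypothesis `hCU`, supplied by pinning both coins), the data `x̂ ≤ x`
decreasing, and both shifts `≤ 0` (`shift_mem₂_of_tracePA`). -/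
theorem cylinder₂_block_nonneg (P : Finset V) {v v' : V} (μ x y xh yh : Finset V → R)
    (hμ : ∀ Z ∈ P.powerset, 0 ≤ μ Z)
    (hx1 : ∀ Z : Finset V, Z ⊆ P → x Z ≤ 1) (hy1 : ∀ Z : Finset V, Z ⊆ P → y Z ≤ 1)
    (hxh1 : ∀ Z : Finset V, Z ⊆ P → xh Z ≤ 1) (hyh1 : ∀ Z : Finset V, Z ⊆ P → yh Z ≤ 1)
    (hxanti : ∀ Z Z' : Finset V, Z ⊆ Z' → Z' ⊆ P → x Z' ≤ x Z)
    (hyanti : ∀ Z Z' : Finset V, Z ⊆ Z' → Z' ⊆ P → y Z' ≤ y Z)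
    (hxhanti : ∀ Z Z' : Finset V, Z ⊆ Z' → Z' ⊆ P → xh Z' ≤ xh Z)
    (hyhanti : ∀ Z Z' : Finset V, Z ⊆ Z' → Z' ⊆ P → yh Z' ≤ yh Z)
    (hxh_le : ∀ Z : Finset V, Z ⊆ P → xh Z ≤ x Z) (hyh_le : ∀ Z : Finset V, Z ⊆ P → yh Z ≤ y Z)
    (hPA : TracePA P μ)
    (hCU : ∀ f₁ f₂ : Finset V → R,
      (∀ Z Z' : Finset V, Z ⊆ Z' → Z' ⊆ P → f₁ Z ≤ f₁ Z') →
      (∀ Z Z' : Finset V, Z ⊆ Z' → Z' ⊆ P → f₂ Z ≤ f₂ Z') →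
      (∀ Z : Finset V, Z ⊆ P → 0 ≤ f₁ Z) → (∀ Z : Finset V, Z ⊆ P → 0 ≤ f₂ Z) →
      (∑ Z ∈ P.powerset.filter (fun Z => v ∈ Z ∧ v' ∈ Z), f₁ Z * μ Z) *
          (∑ Z ∈ P.powerset.filter (fun Z => v ∈ Z ∧ v' ∈ Z), f₂ Z * μ Z) ≤
        (∑ Z ∈ P.powerset.filter (fun Z => v ∈ Z ∧ v' ∈ Z), f₁ Z * f₂ Z * μ Z) *
          ∑ Z ∈ P.powerset.filter (fun Z => v ∈ Z ∧ v' ∈ Z), μ Z) :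
    0 ≤ ∑ Z ∈ P.powerset.filter (fun Z => v ∈ Z ∧ v' ∈ Z),
      μ Z * (xh Z * (∑ Z' ∈ P.powerset, μ Z') - ∑ Z' ∈ P.powerset, x Z' * μ Z') *
        (yh Z * (∑ Z' ∈ P.powerset, μ Z') - ∑ Z' ∈ P.powerset, y Z' * μ Z') := by
  have hΛn : 0 ≤ ∑ Z' ∈ P.powerset, μ Z' := Finset.sum_nonneg hμ
  refine block_nonneg _ μ xh yh _ _ _ (fun Z hZ => hμ Z (Finset.mem_filter.mp hZ).1) ?_
    (Or.inr ⟨?_, ?_⟩)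
  · exact hCU (fun Z => 1 - xh Z) (fun Z => 1 - yh Z)
      (fun Z Z' h h' => by show 1 - xh Z ≤ 1 - xh Z'; linarith [hxhanti Z Z' h h'])
      (fun Z Z' h h' => by show 1 - yh Z ≤ 1 - yh Z'; linarith [hyhanti Z Z' h h'])
      (fun Z h => by show 0 ≤ 1 - xh Z; linarith [hxh1 Z h])
      (fun Z h => by show 0 ≤ 1 - yh Z; linarith [hyh1 Z h])
  · have h1 := shift_mem₂_of_tracePA P μ x hPA hx1 hxanti v v'
    have h2 : ∑ Z ∈ P.powerset.filter (fun Z => v ∈ Z ∧ v' ∈ Z), xh Z * μ Z ≤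
        ∑ Z ∈ P.powerset.filter (fun Z => v ∈ Z ∧ v' ∈ Z), x Z * μ Z :=
      Finset.sum_le_sum fun Z hZ => mul_le_mul_of_nonneg_right
        (hxh_le Z (Finset.mem_powerset.mp (Finset.mem_filter.mp hZ).1))
        (hμ Z (Finset.mem_filter.mp hZ).1)
    exact (mul_le_mul_of_nonneg_right h2 hΛn).trans h1
  · have h1 := shift_mem₂_of_tracePA P μ y hPA hy1 hyanti v v'
    have h2 : ∑ Z ∈ P.powerset.filter (fun Z => v ∈ Z ∧ v' ∈ Z), yh Z * μ Z ≤
        ∑ Z ∈ P.powerset.filter (fun Z => v ∈ Z ∧ v' ∈ Z), y Z * μ Z :=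
      Finset.sum_le_sum fun Z hZ => mul_le_mul_of_nonneg_right
        (hyh_le Z (Finset.mem_powerset.mp (Finset.mem_filter.mp hZ).1))
        (hμ Z (Finset.mem_filter.mp hZ).1)
    exact (mul_le_mul_of_nonneg_right h2 hΛn).trans h1

end Blocks2

end Summit.Ventures.PercRepro2.Coin
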